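import Mathlib.Analysis.Normed.Module.Basic
import Mathlib.Analysis.SpecialFunctions.Pow.Real
import Mathlib.Topology.MetricSpace.Lipschitz
import Mathlib.Analysis.Calculus.FDeriv.Basic
import Mathlib.Analysis.Calculus.Deriv.Basic
import Literature.Analysis.FunctionSpaces.HolderNorm
import HarnessLib

/-!
# Parabolic spacetime and parabolic Hölder norms (White 2005, §2.1 and §8)

B. White, *A local regularity theorem for mean curvature flow*, Ann. of Math. 161 (2005):
§2.1 (p. 1491): "We will work in spacetime `R^{N,1} = R^N × R`. … If `X = (x, t)` is a point in
spacetime, `‖X‖` denotes its parabolic norm: `‖X‖ = ‖(x, t)‖ = max{|x|, |t|^{1/2}}`. The norm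
makes spacetime into a metric space, the distance between `X` and `Y` being `‖X - Y‖`. … For
`λ > 0`, we let `D_λ : R^{N,1} → R^{N,1}` denote the parabolic dilation: `D_λ(x, t) = (λx, λ²t)`.
Note that `‖D_λ X‖ = λ‖X‖`."  §8 (p. 1515): "Suppose `W` is an open subset of the spacetime
`R^{n,1}`. If `u` is a map from `W` to a Euclidean space, then `[u]_α = sup_{X ≠ Y ∈ W}
|u(X) - u(Y)| / ‖X - Y‖^α`, `‖u‖_{0,α} = sup_W |u(X)| + [u]_α`. Of course `‖X - Y‖` denotes the
parabolic distance from `X` to `Y`.  If `p` is a nonnegative integer and `0 < α < 1`, we let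
`‖u‖_{p,α} = ∑_{j+2k≤p} ‖D^j (∂_t)^k u‖_{0,α}`.  Here `D` denotes the derivative with respect to
the spatial variables."

This file provides that vocabulary — the first layer (parabolic Hölder spaces) of the machinery
behind White's theorem (the tree's named fact
`Literature.Geometry.Riemannian.White2005_localRegularity_cylinderFlowSheet` and its TODO(general
form)) and of parabolic Schauder theory in general — as DEFINITIONS with proved API, no facts:

* `Parabolic E` — spacetime over `E`, points `⟨x, t⟩`; `Parabolic.equivProd : Parabolic E ≃ E × ℝ`;
  the additive group structure is transported from `E × ℝ`;
* the parabolic metric `dist X Y = max (dist X.x Y.x) √(dist X.t Y.t)` as a `(Pseudo)MetricSpace`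
  INSTANCE on the synonym (`Parabolic.dist_eq`, `dist_x_le`, `sqrt_dist_t_le`, `dist_t_le_sq`,
  `dist_le_iff`, `dist_lt_iff`), so that Mathlib's metric notions (`HolderWith`, `eHolderNorm`,
  balls — `ball 0 1` IS White's `B^{N,1} = B^N × (-1, 1)` —, Arzelà–Ascoli, …) apply verbatim;
* translation invariance (`dist_add_right`, `dist_sub_right`, `dist_zero_right` = White's `‖X‖`)
  and the **dilations** `Parabolic.dilation c ⟨x, t⟩ = ⟨c • x, c² t⟩` with
  `dist (dilation c X) (dilation c Y) = c * dist X Y` for `c ≥ 0` (`dist_dilation`),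
  `dilation_dilation`, `dilationEquiv`, `image_dilation_ball`;
* `Parabolic.homeomorphProd`: the parabolic metric induces the product topology (it is NOT
  bi-Lipschitz to the product metric — time enters through a square root);
* `Parabolic.holderNormOn α v W ∈ [0, ∞]` — White's `‖v‖_{0,α}` on a set `W` (the tree's
  `eBoundedHolderNorm` of `W.restrict v` for the parabolic metric), with `enorm_le_holderNormOn`,
  `edist_le_holderNormOn_mul`, `holderNormOn_mono`, `holderNormOn_const`;
* `Parabolic.spaceDeriv u` (`D u`, a continuous linear map), `Parabolic.timeDeriv u` (`∂ₜ u`), the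
  regularity guard `IsC21On u W`, and White's `‖u‖_{2,α}`: `Parabolic.c2αNormOn α u W =
  ‖u‖_{0,α} + ‖Du‖_{0,α} + ‖D²u‖_{0,α} + ‖∂ₜu‖_{0,α}` (`= ∞` off the guard, so that finiteness is
  honest despite the junk values of `fderiv`/`deriv`), with the component bounds and monotonicity.

Design: `Parabolic E` is a `structure` (no defeq abuse with `E × ℝ`, which carries the sup
metric); calculus is done through the coordinates.  `Du`, `D²u` are measured in operator norm —
any other choice of (equivalent, finite-dimensional) norms gives an equivalent `‖·‖_{2,α}`, to
which White's theory is insensitive (Remark after Thm. 8.1).  The tree's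
`Literature.Analysis.FluidPDE.parabolicDist` (Navier–Stokes files) is the special case `ℝ × ℝ³`,
time-first, in the equivalent SUM form `|t-s|^{1/2} + ‖x-y‖` (`max ≤ sum ≤ 2 max`); nothing
there is duplicated here.  NOT here: compactness of `{‖u‖_{2,α} ≤ 1}` in `C⁰` (White Thm. 8.1 /
Arzelà–Ascoli), the Schauder estimates (Thm. 8.2), `K_{2,α}` (§2.5, separate file).

## References

* [White2005] B. White, Ann. of Math. 161 (2005) 1487–1519, §2.1, §8 (p. 1515).
* G. Lieberman, *Second order parabolic differential equations* (1996), Ch. IV §1 (parabolic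
  distance and parabolic Hölder norms).
-/

noncomputable section

open Metric Set Filter
open scoped NNReal ENNReal Topology

namespace Literature.Analysis.PDE

/-- **Parabolic spacetime** over `E`: the points `X = ⟨x, t⟩`, `x : E` (space), `t : ℝ` (time), to
be equipped with White's parabolic metric `max(dist x y, |t - s|^{1/2})` (White 2005, §2.1).
[cite: White2005, §2.1] -/
@[ext]
structure Parabolic (E : Type*) where
  /-- the space coordinate of a spacetime point -/
  x : E
  /-- the time coordinate of a spacetime point -/
  t : ℝ

namespace Parabolic

variable {E : Type*}

/-- Spacetime points are pairs: `Parabolic E ≃ E × ℝ`. [cite: White2005, §2.1] -/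
def equivProd : Parabolic E ≃ E × ℝ where
  toFun X := (X.x, X.t)
  invFun p := ⟨p.1, p.2⟩
  left_inv _ := rfl
  right_inv _ := rfl

/-- `equivProd` on a point. [cite: White2005, §2.1] -/
@[simp] theorem equivProd_apply (X : Parabolic E) : equivProd X = (X.x, X.t) := rfl
/-- `equivProd.symm` on a pair. [cite: White2005, §2.1] -/
@[simp] theorem equivProd_symm_apply (p : E × ℝ) : equivProd.symm p = ⟨p.1, p.2⟩ := rfl

/-- Spacetime is an additive group, coordinatewise (transported from `E × ℝ`; White 2005, §2.1:
translations `M - X`). [cite: White2005, §2.1] -/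
instance [AddCommGroup E] : AddCommGroup (Parabolic E) := equivProd.addCommGroup

section AddGroup

variable [AddCommGroup E]

/-- The `x` coordinate of `a sum` in spacetime (transported from `E × ℝ`). [folklore] -/
@[simp] theorem add_x (X Y : Parabolic E) : (X + Y).x = X.x + Y.x := rfl
/-- The `t` coordinate of `a sum` in spacetime (transported from `E × ℝ`). [folklore] -/
@[simp] theorem add_t (X Y : Parabolic E) : (X + Y).t = X.t + Y.t := rfl
/-- The `x` coordinate of `a difference` in spacetime (transported from `E × ℝ`). [folklore] -/
@[simp] theorem sub_x (X Y : Parabolic E) : (X - Y).x = X.x - Y.x := rfl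
/-- The `t` coordinate of `a difference` in spacetime (transported from `E × ℝ`). [folklore] -/
@[simp] theorem sub_t (X Y : Parabolic E) : (X - Y).t = X.t - Y.t := rfl
/-- The `x` coordinate of `a negation` in spacetime (transported from `E × ℝ`). [folklore] -/
@[simp] theorem neg_x (X : Parabolic E) : (-X).x = -X.x := rfl
/-- The `t` coordinate of `a negation` in spacetime (transported from `E × ℝ`). [folklore] -/
@[simp] theorem neg_t (X : Parabolic E) : (-X).t = -X.t := rfl
/-- The `x` coordinate of `zero` in spacetime (transported from `E × ℝ`). [folklore] -/
@[simp] theorem zero_x : (0 : Parabolic E).x = 0 := rfl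
/-- The `t` coordinate of `zero` in spacetime (transported from `E × ℝ`). [folklore] -/
@[simp] theorem zero_t : (0 : Parabolic E).t = 0 := rfl

end AddGroup

/-! ### The parabolic metric -/

section Metric

variable [PseudoMetricSpace E]

/-- White's **parabolic metric** `dist X Y = max (dist x y) (dist t s)^{1/2}` on spacetime
(White 2005, §2.1; Lieberman 1996, IV.1). [cite: White2005, §2.1] -/
instance instPseudoMetricSpace : PseudoMetricSpace (Parabolic E) where
  dist X Y := max (dist X.x Y.x) (Real.sqrt (dist X.t Y.t))
  dist_self X := by simp
  dist_comm X Y := by simp only [dist_comm]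
  dist_triangle X Y Z := by
    refine max_le ?_ ?_
    · exact (dist_triangle X.x Y.x Z.x).trans (add_le_add (le_max_left _ _) (le_max_left _ _))
    · -- `√(a + b) ≤ √a + √b` (landed elsewhere as `…MRT2015.sqrt_add_le_sqrt_add_sqrt`, a number
      -- theory file not imported here to keep the import closure analytic)
      have hsub : Real.sqrt (dist X.t Y.t + dist Y.t Z.t) ≤
          Real.sqrt (dist X.t Y.t) + Real.sqrt (dist Y.t Z.t) := by
        rw [Real.sqrt_le_left (by positivity)]
        nlinarith [Real.sq_sqrt (dist_nonneg : 0 ≤ dist X.t Y.t),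
          Real.sq_sqrt (dist_nonneg : 0 ≤ dist Y.t Z.t), Real.sqrt_nonneg (dist X.t Y.t),
          Real.sqrt_nonneg (dist Y.t Z.t)]
      calc Real.sqrt (dist X.t Z.t) ≤ Real.sqrt (dist X.t Y.t + dist Y.t Z.t) :=
            Real.sqrt_le_sqrt (dist_triangle _ _ _)
        _ ≤ Real.sqrt (dist X.t Y.t) + Real.sqrt (dist Y.t Z.t) := hsub
        _ ≤ _ := add_le_add (le_max_right _ _) (le_max_right _ _)

/-- The parabolic distance, unfolded. [cite: White2005, §2.1] -/
theorem dist_eq (X Y : Parabolic E) :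
    dist X Y = max (dist X.x Y.x) (Real.sqrt (dist X.t Y.t)) := rfl

/-- The spatial distance is at most the parabolic distance. [cite: White2005, §2.1] -/
theorem dist_x_le (X Y : Parabolic E) : dist X.x Y.x ≤ dist X Y := le_max_left _ _

/-- The square root of the time distance is at most the parabolic distance.
[cite: White2005, §2.1] -/
theorem sqrt_dist_t_le (X Y : Parabolic E) : Real.sqrt (dist X.t Y.t) ≤ dist X Y := le_max_right _ _

/-- The time distance is at most the SQUARE of the parabolic distance. [cite: White2005, §2.1] -/
theorem dist_t_le_sq (X Y : Parabolic E) : dist X.t Y.t ≤ dist X Y ^ 2 := by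
  calc dist X.t Y.t = Real.sqrt (dist X.t Y.t) ^ 2 := (Real.sq_sqrt dist_nonneg).symm
    _ ≤ dist X Y ^ 2 := pow_le_pow_left₀ (Real.sqrt_nonneg _) (sqrt_dist_t_le X Y) 2

/-- A parabolic distance bound is a spatial bound together with a squared time bound.
[cite: White2005, §2.1] -/
theorem dist_le_iff (X Y : Parabolic E) {r : ℝ} (hr : 0 ≤ r) :
    dist X Y ≤ r ↔ dist X.x Y.x ≤ r ∧ dist X.t Y.t ≤ r ^ 2 := by
  rw [dist_eq, max_le_iff, Real.sqrt_le_left hr]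

/-- Strict version of `dist_le_iff`. [cite: White2005, §2.1] -/
theorem dist_lt_iff (X Y : Parabolic E) {r : ℝ} (hr : 0 < r) :
    dist X Y < r ↔ dist X.x Y.x < r ∧ dist X.t Y.t < r ^ 2 := by
  rw [dist_eq, max_lt_iff, Real.sqrt_lt' hr]

/-- The space projection is `1`-Lipschitz for the parabolic metric. [cite: White2005, §2.1] -/
theorem lipschitzWith_x : LipschitzWith 1 (fun X : Parabolic E => X.x) :=
  LipschitzWith.of_dist_le_mul fun X Y => by simpa using dist_x_le X Y

/-- The space coordinate is continuous. [cite: White2005, §2.1] -/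
theorem continuous_x : Continuous fun X : Parabolic E => X.x := lipschitzWith_x.continuous

/-- The time coordinate is continuous (it is `1/2`-Hölder, not Lipschitz).
[cite: White2005, §2.1] -/
theorem continuous_t : Continuous fun X : Parabolic E => X.t := by
  refine Metric.continuous_iff.2 fun X ε hε => ⟨Real.sqrt ε, Real.sqrt_pos.2 hε, fun Y hY => ?_⟩
  calc dist Y.t X.t ≤ dist Y X ^ 2 := dist_t_le_sq Y X
    _ < Real.sqrt ε ^ 2 := pow_lt_pow_left₀ hY dist_nonneg two_ne_zero
    _ = ε := Real.sq_sqrt hε.le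

/-- **The parabolic metric induces the product topology**: the identification with `E × ℝ` is a
homeomorphism. [cite: White2005, §2.1] -/
def homeomorphProd : Parabolic E ≃ₜ E × ℝ where
  toEquiv := equivProd
  continuous_toFun := continuous_x.prodMk continuous_t
  continuous_invFun := by
    refine Metric.continuous_iff.2 fun p ε hε => ⟨min ε (ε ^ 2), by positivity, fun q hq => ?_⟩
    rw [dist_lt_iff _ _ hε]
    rw [Prod.dist_eq, max_lt_iff] at hq
    exact ⟨hq.1.trans_le (min_le_left _ _), hq.2.trans_le (min_le_right _ _)⟩

/-- `homeomorphProd` on a point. [cite: White2005, §2.1] -/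
@[simp] theorem homeomorphProd_apply (X : Parabolic E) : homeomorphProd X = (X.x, X.t) := rfl
/-- `homeomorphProd.symm` on a pair. [cite: White2005, §2.1] -/
@[simp] theorem homeomorphProd_symm_apply (p : E × ℝ) : homeomorphProd.symm p = ⟨p.1, p.2⟩ := rfl

end Metric

/-- The parabolic metric is a genuine metric when the space metric is. [cite: White2005, §2.1] -/
instance instMetricSpace [MetricSpace E] : MetricSpace (Parabolic E) where
  eq_of_dist_eq_zero {X Y} h := by
    have hx : dist X.x Y.x ≤ 0 := (dist_x_le X Y).trans_eq h
    have ht : dist X.t Y.t ≤ 0 := by simpa [h] using dist_t_le_sq X Y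
    ext
    · exact dist_le_zero.1 hx
    · exact dist_le_zero.1 ht

/-! ### Translations and dilations -/

section Normed

variable [NormedAddCommGroup E]

/-- The parabolic metric is translation invariant. [cite: White2005, §2.1] -/
theorem dist_add_right (X Y Z : Parabolic E) : dist (X + Z) (Y + Z) = dist X Y := by
  simp [dist_eq, dist_eq_norm]

/-- The parabolic metric is translation invariant. [cite: White2005, §2.1] -/
theorem dist_sub_right (X Y Z : Parabolic E) : dist (X - Z) (Y - Z) = dist X Y := by
  simp [dist_eq, dist_eq_norm]

/-- White's parabolic norm `‖X‖ = max(|x|, |t|^{1/2})` is the distance to the origin.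
[cite: White2005, §2.1] -/
theorem dist_zero_right (X : Parabolic E) : dist X 0 = max ‖X.x‖ (Real.sqrt |X.t|) := by
  simp [dist_eq]

variable [NormedSpace ℝ E]

/-- The **parabolic dilation** `D_c ⟨x, t⟩ = ⟨c x, c² t⟩` (White 2005, §2.1).
[cite: White2005, §2.1] -/
def dilation (c : ℝ) (X : Parabolic E) : Parabolic E := ⟨c • X.x, c ^ 2 * X.t⟩

/-- The space coordinate of a dilated point. [cite: White2005, §2.1] -/
@[simp] theorem dilation_x (c : ℝ) (X : Parabolic E) : (dilation c X).x = c • X.x := rfl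
/-- The time coordinate of a dilated point. [cite: White2005, §2.1] -/
@[simp] theorem dilation_t (c : ℝ) (X : Parabolic E) : (dilation c X).t = c ^ 2 * X.t := rfl

/-- `D_1 = id`. [cite: White2005, §2.1] -/
@[simp] theorem dilation_one (X : Parabolic E) : dilation 1 X = X := by
  ext <;> simp

/-- `D_c ∘ D_{c'} = D_{c c'}`. [cite: White2005, §2.1] -/
theorem dilation_dilation (c c' : ℝ) (X : Parabolic E) :
    dilation c (dilation c' X) = dilation (c * c') X := by
  ext <;> simp [mul_smul, dilation]; ring

/-- Dilations are additive. [cite: White2005, §2.1] -/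
theorem dilation_add (c : ℝ) (X Y : Parabolic E) :
    dilation c (X + Y) = dilation c X + dilation c Y := by
  ext <;> simp [dilation, smul_add, mul_add]

/-- Dilations commute with subtraction. [cite: White2005, §2.1] -/
theorem dilation_sub (c : ℝ) (X Y : Parabolic E) :
    dilation c (X - Y) = dilation c X - dilation c Y := by
  ext <;> simp [dilation, smul_sub, mul_sub]

/-- **`‖D_c X - D_c Y‖ = c ‖X - Y‖`** for `c ≥ 0` (White 2005, §2.1: "`‖D_λ X‖ = λ‖X‖`").
[cite: White2005, §2.1] -/
theorem dist_dilation {c : ℝ} (hc : 0 ≤ c) (X Y : Parabolic E) :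
    dist (dilation c X) (dilation c Y) = c * dist X Y := by
  rw [dist_eq, dist_eq, dilation_x, dilation_x, dilation_t, dilation_t, dist_smul₀,
    Real.norm_eq_abs,
    abs_of_nonneg hc, Real.dist_eq, Real.dist_eq, ← mul_sub, abs_mul, abs_of_nonneg (sq_nonneg c),
    Real.sqrt_mul (sq_nonneg c), Real.sqrt_sq hc, mul_max_of_nonneg _ _ hc]

/-- For `c > 0` the dilation `D_c` is a bijection with inverse `D_{c⁻¹}`. [cite: White2005, §2.1] -/
def dilationEquiv {c : ℝ} (hc : 0 < c) : Parabolic E ≃ Parabolic E where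
  toFun := dilation c
  invFun := dilation c⁻¹
  left_inv X := by rw [dilation_dilation, inv_mul_cancel₀ hc.ne', dilation_one]
  right_inv X := by rw [dilation_dilation, mul_inv_cancel₀ hc.ne', dilation_one]

/-- Images and preimages under dilations: `D_c '' A = D_{c⁻¹} ⁻¹' A`. [cite: White2005, §2.1] -/
theorem image_dilation {c : ℝ} (hc : 0 < c) (A : Set (Parabolic E)) :
    dilation c '' A = dilation c⁻¹ ⁻¹' A := by
  ext X
  constructor
  · rintro ⟨Y, hY, rfl⟩
    simpa [dilation_dilation, inv_mul_cancel₀ hc.ne'] using hY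
  · intro hX
    exact ⟨dilation c⁻¹ X, hX, by rw [dilation_dilation, mul_inv_cancel₀ hc.ne', dilation_one]⟩

/-- Dilations map parabolic balls to parabolic balls: `D_c B(X, r) = B(D_c X, c r)`.
[cite: White2005, §2.1] -/
theorem image_dilation_ball {c : ℝ} (hc : 0 < c) (X : Parabolic E) (r : ℝ) :
    dilation c '' ball X r = ball (dilation c X) (c * r) := by
  ext Y
  rw [image_dilation hc, mem_preimage, mem_ball, mem_ball]
  have h : dist Y (dilation c X) = c * dist (dilation c⁻¹ Y) X := by
    conv_lhs => rw [show Y = dilation c (dilation c⁻¹ Y) by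
      rw [dilation_dilation, mul_inv_cancel₀ hc.ne', dilation_one]]
    exact dist_dilation hc.le _ _
  rw [h]
  exact (mul_lt_mul_iff_of_pos_left hc).symm

end Normed

end Parabolic


/-! ## Parabolic Hölder norms (White 2005, §8, p. 1515) -/

namespace Parabolic

open Literature.Analysis.FunctionSpaces

section HolderNorm

variable {E G : Type*} [PseudoMetricSpace E] [NormedAddCommGroup G]

/-- The **parabolic `C^{0,α}` norm on a set** `W` of spacetime of a function `v`:
`‖v‖_{0,α;W} = sup_W ‖v‖ + [v]_{α;W}`, where the Hölder seminorm
`[v]_α = sup_{X ≠ Y ∈ W} ‖v X - v Y‖ / ‖X - Y‖^α` is taken for the PARABOLIC distance (White 2005,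
§8 p. 1515: "`[u]_α = sup |u(X) - u(Y)| / ‖X - Y‖^α`, `‖u‖_{0,α} = sup |u(X)| + [u]_α`. Of course
`‖X - Y‖` denotes the parabolic distance").  Implemented as the tree's inhomogeneous Hölder norm
`eBoundedHolderNorm` of the restriction `W.restrict v` (the subtype `W` carries the parabolic
metric); value in `[0, ∞]`. [cite: White2005, §8 p. 1515] -/
def holderNormOn (α : ℝ≥0) (v : Parabolic E → G) (W : Set (Parabolic E)) : ℝ≥0∞ :=
  eBoundedHolderNorm α (W.restrict v)

/-- Unfolding the parabolic `C^{0,α}` norm. [cite: White2005, §8 p. 1515] -/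
theorem holderNormOn_eq (α : ℝ≥0) (v : Parabolic E → G) (W : Set (Parabolic E)) :
    holderNormOn α v W = eSupNorm (W.restrict v) + eHolderNorm α (W.restrict v) := rfl

/-- Pointwise bound by the parabolic `C^{0,α}` norm: `‖v X‖ ≤ ‖v‖_{0,α;W}` for `X ∈ W`.
[cite: White2005, §8 p. 1515] -/
theorem enorm_le_holderNormOn (α : ℝ≥0) (v : Parabolic E → G) {W : Set (Parabolic E)}
    {X : Parabolic E} (hX : X ∈ W) : ‖v X‖ₑ ≤ holderNormOn α v W :=
  (enorm_le_eSupNorm (W.restrict v) ⟨X, hX⟩).trans le_self_add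

/-- Monotonicity of the parabolic `C^{0,α}` norm in the set. [cite: White2005, §8 p. 1515] -/
theorem holderNormOn_mono (α : ℝ≥0) (v : Parabolic E → G) {W W' : Set (Parabolic E)}
    (h : W ⊆ W') : holderNormOn α v W ≤ holderNormOn α v W' := by
  rw [holderNormOn_eq, holderNormOn_eq]
  refine add_le_add (iSup_le fun X => enorm_le_eSupNorm (W'.restrict v) ⟨X, h X.2⟩) ?_
  refine le_iInf₂ fun C hC => ?_
  refine iInf₂_le C ?_
  intro X Y
  exact hC ⟨X, h X.2⟩ ⟨Y, h Y.2⟩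

/-- The parabolic `C^{0,α}` norm of a constant is its norm (on a nonempty set).
[cite: White2005, §8 p. 1515] -/
theorem holderNormOn_const (α : ℝ≥0) (c : G) {W : Set (Parabolic E)} (hW : W.Nonempty) :
    holderNormOn α (fun _ : Parabolic E => c) W = ‖c‖ₑ := by
  rw [holderNormOn_eq]
  have h1 : eSupNorm (W.restrict fun _ : Parabolic E => c) = ‖c‖ₑ := by
    haveI : Nonempty W := hW.to_subtype
    simp [eSupNorm]
  have h2 : eHolderNorm α (W.restrict fun _ : Parabolic E => c) = 0 := by
    rw [show W.restrict (fun _ : Parabolic E => c) = Function.const _ c from rfl]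
    exact eHolderNorm_const _ α c
  rw [h1, h2, add_zero]

/-- The parabolic `C^{0,α}` norm of `0` vanishes. [cite: White2005, §8 p. 1515] -/
@[simp] theorem holderNormOn_zero (α : ℝ≥0) (W : Set (Parabolic E)) :
    holderNormOn α (0 : Parabolic E → G) W = 0 := by
  rw [holderNormOn_eq]
  simp [show W.restrict (0 : Parabolic E → G) = 0 from rfl]

/-- The Hölder bound encoded by the parabolic `C^{0,α}` norm:
`‖v X - v Y‖ ≤ ‖v‖_{0,α;W} · ‖X - Y‖^α` for `X, Y ∈ W` (parabolic distance).
[cite: White2005, §8 p. 1515] -/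
theorem edist_le_holderNormOn_mul {E : Type*} [MetricSpace E] (α : ℝ≥0) (v : Parabolic E → G)
    {W : Set (Parabolic E)} {X Y : Parabolic E} (hX : X ∈ W) (hY : Y ∈ W) :
    edist (v X) (v Y) ≤ holderNormOn α v W * edist X Y ^ (α : ℝ) := by
  by_cases h : MemHolder α (W.restrict v)
  · have hH := h.holderWith ⟨X, hX⟩ ⟨Y, hY⟩
    simp only [Set.restrict_apply] at hH
    refine hH.trans (mul_le_mul' ?_ (le_of_eq rfl))
    calc ((nnHolderNorm α (W.restrict v) : ℝ≥0) : ℝ≥0∞) ≤ eHolderNorm α (W.restrict v) :=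
          coe_nnHolderNorm_le_eHolderNorm
      _ ≤ holderNormOn α v W := le_add_self
  · have htop : holderNormOn α v W = ∞ := by
      rw [holderNormOn_eq, ← eHolderNorm_ne_top, not_ne_iff] at *
      rw [h, add_top]
    rw [htop]
    by_cases hXY : edist X Y = 0
    · have : X = Y := edist_eq_zero.1 hXY
      subst this
      simp
    · rw [ENNReal.top_mul (by simp [hXY])]
      exact le_top

end HolderNorm

/-! ### Space and time derivatives -/

section TimeDeriv

variable {E F : Type*} [NormedAddCommGroup F] [NormedSpace ℝ F]

/-- The **time derivative** `∂ₜ u (x, t)` of a function on spacetime (derivative of `u(x, ·)` at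
`t`; junk value `0` where it does not exist). [cite: White2005, §8 p. 1515] -/
def timeDeriv (u : Parabolic E → F) (X : Parabolic E) : F :=
  deriv (fun t => u ⟨X.x, t⟩) X.t

/-- Unfolding the time derivative. [cite: White2005, §8 p. 1515] -/
theorem timeDeriv_apply (u : Parabolic E → F) (X : Parabolic E) :
    timeDeriv u X = deriv (fun t => u ⟨X.x, t⟩) X.t := rfl

/-- The time derivative of a constant vanishes. [folklore] -/
@[simp] theorem timeDeriv_const (c : F) : timeDeriv (fun _ : Parabolic E => c) = 0 := by
  funext X; simp [timeDeriv]

end TimeDeriv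

section SpaceDeriv

variable {E F : Type*} [NormedAddCommGroup E] [NormedSpace ℝ E] [NormedAddCommGroup F]
  [NormedSpace ℝ F]

/-- The **spatial derivative** `D u (x, t) = ∂u/∂x (x, t) ∈ L(E, F)` of a function on spacetime
(Fréchet derivative of `u(·, t)` at `x`; junk value `0` where it does not exist).
[cite: White2005, §8 p. 1515] -/
def spaceDeriv (u : Parabolic E → F) (X : Parabolic E) : E →L[ℝ] F :=
  fderiv ℝ (fun x => u ⟨x, X.t⟩) X.x

/-- Unfolding the spatial derivative. [cite: White2005, §8 p. 1515] -/
theorem spaceDeriv_apply (u : Parabolic E → F) (X : Parabolic E) :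
    spaceDeriv u X = fderiv ℝ (fun x => u ⟨x, X.t⟩) X.x := rfl

/-- The spatial derivative of a constant vanishes. [folklore] -/
@[simp] theorem spaceDeriv_const (c : F) : spaceDeriv (fun _ : Parabolic E => c) = 0 := by
  funext X; simp [spaceDeriv]

/-- The regularity guard of the parabolic `C^{2,α}` norm on a set `W`: `u` is (jointly, Fréchet)
differentiable at the points of `W` — so that `D u`, `∂ₜ u` are genuine partial derivatives — and
`D u` is differentiable in space there (so that `D² u` is genuine).  White's `C^{2,α}` functions on
an open `W` satisfy it (continuous `D²u`, `∂ₜu` give joint differentiability).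
[cite: White2005, §8 p. 1515] -/
structure IsC21On (u : Parabolic E → F) (W : Set (Parabolic E)) : Prop where
  /-- joint differentiability at the points of `W` -/
  differentiableAt : ∀ X ∈ W, DifferentiableAt ℝ (fun p : E × ℝ => u ⟨p.1, p.2⟩) (X.x, X.t)
  /-- the spatial derivative is differentiable in space at the points of `W` -/
  differentiableAt_spaceDeriv : ∀ X ∈ W, DifferentiableAt ℝ (fun x => spaceDeriv u ⟨x, X.t⟩) X.x

/-- Constants satisfy the regularity guard. [folklore] -/
theorem isC21On_const (c : F) (W : Set (Parabolic E)) : IsC21On (fun _ : Parabolic E => c) W :=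
  ⟨fun _ _ => differentiableAt_const c, fun _ _ => by simp⟩

/-- The guard is monotone in the set. [folklore] -/
theorem IsC21On.mono {u : Parabolic E → F} {W W' : Set (Parabolic E)} (h : IsC21On u W')
    (hW : W ⊆ W') :
    IsC21On u W :=
  ⟨fun X hX => h.1 X (hW hX), fun X hX => h.2 X (hW hX)⟩

/-- The **parabolic `C^{2,α}` norm on a set** `W`:
`‖u‖_{2,α;W} = ∑_{j+2k≤2} ‖D^j ∂ₜ^k u‖_{0,α;W} = ‖u‖_{0,α} + ‖Du‖_{0,α} + ‖D²u‖_{0,α} + ‖∂ₜu‖_{0,α}`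
(White 2005, §8 p. 1515, `p = 2`), each term a parabolic `C^{0,α}` norm on `W` (`holderNormOn`;
`Du`, `D²u` measured in operator norm), and `= ∞` unless the regularity guard `IsC21On u W` holds
(so that finiteness of the norm means `u ∈ C^{2,α}` honestly — Mathlib's `fderiv`/`deriv` return
`0` at points of non-differentiability).  Any two such norms built from different (equivalent)
finite-dimensional norms on the derivatives are equivalent; White's theory is insensitive to the
choice (Remark after Thm. 8.1). [cite: White2005, §8 p. 1515] -/
def c2αNormOn (α : ℝ≥0) (u : Parabolic E → F) (W : Set (Parabolic E)) : ℝ≥0∞ :=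
  ⨅ (_ : IsC21On u W), holderNormOn α u W + holderNormOn α (spaceDeriv u) W +
    holderNormOn α (spaceDeriv (spaceDeriv u)) W + holderNormOn α (timeDeriv u) W

/-- The parabolic `C^{2,α}` norm under the regularity guard. [cite: White2005, §8 p. 1515] -/
theorem c2αNormOn_eq {α : ℝ≥0} {u : Parabolic E → F} {W : Set (Parabolic E)} (h : IsC21On u W) :
    c2αNormOn α u W = holderNormOn α u W + holderNormOn α (spaceDeriv u) W +
      holderNormOn α (spaceDeriv (spaceDeriv u)) W + holderNormOn α (timeDeriv u) W := by
  rw [c2αNormOn, iInf_pos h]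

/-- Without the regularity guard the parabolic `C^{2,α}` norm is `∞`.
[cite: White2005, §8 p. 1515] -/
theorem c2αNormOn_of_not {α : ℝ≥0} {u : Parabolic E → F} {W : Set (Parabolic E)}
    (h : ¬ IsC21On u W) :
    c2αNormOn α u W = ∞ := by
  rw [c2αNormOn, iInf_neg h]

/-- A finite parabolic `C^{2,α}` norm entails the regularity guard. [cite: White2005, §8 p. 1515] -/
theorem isC21On_of_c2αNormOn_ne_top {α : ℝ≥0} {u : Parabolic E → F} {W : Set (Parabolic E)}
    (h : c2αNormOn α u W ≠ ∞) : IsC21On u W := by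
  by_contra h'
  exact h (c2αNormOn_of_not h')

/-- `‖u‖_{0,α;W} ≤ ‖u‖_{2,α;W}`. [cite: White2005, §8 p. 1515] -/
theorem holderNormOn_le_c2αNormOn (α : ℝ≥0) (u : Parabolic E → F) (W : Set (Parabolic E)) :
    holderNormOn α u W ≤ c2αNormOn α u W := by
  by_cases h : IsC21On u W
  · rw [c2αNormOn_eq h]
    calc holderNormOn α u W ≤ holderNormOn α u W + holderNormOn α (spaceDeriv u) W := le_self_add
      _ ≤ _ := le_self_add
      _ ≤ _ := le_self_add
  · rw [c2αNormOn_of_not h]; exact le_top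

/-- `‖Du‖_{0,α;W} ≤ ‖u‖_{2,α;W}`. [cite: White2005, §8 p. 1515] -/
theorem holderNormOn_spaceDeriv_le_c2αNormOn (α : ℝ≥0) (u : Parabolic E → F)
    (W : Set (Parabolic E)) :
    holderNormOn α (spaceDeriv u) W ≤ c2αNormOn α u W := by
  by_cases h : IsC21On u W
  · rw [c2αNormOn_eq h]
    calc holderNormOn α (spaceDeriv u) W ≤ holderNormOn α u W + holderNormOn α (spaceDeriv u) W :=
          le_add_self
      _ ≤ _ := le_self_add
      _ ≤ _ := le_self_add
  · rw [c2αNormOn_of_not h]; exact le_top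

/-- `‖D²u‖_{0,α;W} ≤ ‖u‖_{2,α;W}`. [cite: White2005, §8 p. 1515] -/
theorem holderNormOn_spaceDeriv_spaceDeriv_le_c2αNormOn (α : ℝ≥0) (u : Parabolic E → F)
    (W : Set (Parabolic E)) : holderNormOn α (spaceDeriv (spaceDeriv u)) W ≤ c2αNormOn α u W := by
  by_cases h : IsC21On u W
  · rw [c2αNormOn_eq h]
    calc holderNormOn α (spaceDeriv (spaceDeriv u)) W
        ≤ holderNormOn α u W + holderNormOn α (spaceDeriv u) W +
          holderNormOn α (spaceDeriv (spaceDeriv u)) W := le_add_self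
      _ ≤ _ := le_self_add
  · rw [c2αNormOn_of_not h]; exact le_top

/-- `‖∂ₜu‖_{0,α;W} ≤ ‖u‖_{2,α;W}`. [cite: White2005, §8 p. 1515] -/
theorem holderNormOn_timeDeriv_le_c2αNormOn (α : ℝ≥0) (u : Parabolic E → F)
    (W : Set (Parabolic E)) :
    holderNormOn α (timeDeriv u) W ≤ c2αNormOn α u W := by
  by_cases h : IsC21On u W
  · rw [c2αNormOn_eq h]; exact le_add_self
  · rw [c2αNormOn_of_not h]; exact le_top

/-- The parabolic `C^{2,α}` norm is monotone in the set. [cite: White2005, §8 p. 1515] -/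
theorem c2αNormOn_mono (α : ℝ≥0) (u : Parabolic E → F) {W W' : Set (Parabolic E)} (hW : W ⊆ W') :
    c2αNormOn α u W ≤ c2αNormOn α u W' := by
  by_cases h : IsC21On u W'
  · rw [c2αNormOn_eq h, c2αNormOn_eq (h.mono hW)]
    gcongr <;> exact holderNormOn_mono _ _ hW
  · rw [c2αNormOn_of_not h]; exact le_top

/-- The parabolic `C^{2,α}` norm of `0` vanishes. [cite: White2005, §8 p. 1515] -/
@[simp] theorem c2αNormOn_zero (α : ℝ≥0) (W : Set (Parabolic E)) :
    c2αNormOn α (0 : Parabolic E → F) W = 0 := by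
  have h : IsC21On (0 : Parabolic E → F) W := isC21On_const 0 W
  rw [c2αNormOn_eq h]
  have h1 : spaceDeriv (0 : Parabolic E → F) = 0 := spaceDeriv_const (0 : F)
  have h2 : timeDeriv (0 : Parabolic E → F) = 0 := timeDeriv_const (0 : F)
  have h3 : spaceDeriv (0 : Parabolic E → (E →L[ℝ] F)) = 0 := spaceDeriv_const (0 : E →L[ℝ] F)
  simp [h1, h2, h3]

end SpaceDeriv

end Parabolic

end Literature.Analysis.PDE
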